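import Summits.QuantumFields.YangMills.Theorems.UnitScaleTiltHistoryTailAlphaTopFamily
import Literature.MathematicalPhysics.QuantumFieldTheory.Balaban1983to89.B10Eq39CollarVolume

/-!
# Route `UnitScaleTilt` — crux K2 `HistoryTail` (stmt-QuantumFields-18916): THE REACH OF THE COLLAR TOWERS IS `O(x_j^{r₀})` AT LEVEL `j`,
# UNIFORMLY IN THE SOURCE LEVEL — along the coupling flow `g_{K−l} = √(γL^{−(K−l)})` the accumulated collar widths `Σ_{l=i}^{j}(R₁x_l^{r₀} + 2d)M₁L^l`
# of [Balaban1985UV3] (39)/p.268 are at most `3·(R₁·(max 1 r₀)^{r₀}·x_j^{r₀} + 2d)·M₁·L^j`, because `x_l = x_j + (j − l)·log √L` grows linearly in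
# `j − l` while `L^l` decays geometrically; plus the recount of a fine neighbourhood in level-`l` sites (support file; S5 «collars vs cells» geometry of
# the dilute-family bound, both cuts)

Fleet lead `ym-ust-18916-p1` (gen 3), 2026-08-27.  `B10Eq39CollarVolume` (cell pub-ymgap) proves the collar COVER on print's torus —
`exists_source_of_not_mem_omegaSeq`: a site outside `Ω_{j+1}` lies within `radius i j = Σ_{m=i}^{j} width m`, `width m = (R(g_m) + 2d)M₁L^m`, of a
large-field point of some scale `i ≤ j` — and bounds the radius by `(R(g_i) + 2d)M₁L^{j+1}/(L−1)` (`radius_le_of_antitone`), i.e. in terms of the SOURCE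
level's collar `R(g_i) = R₁x_i^{r₀}`, which is unbounded relative to `x_j^{r₀}` as `i → 0`, `K → ∞`.  The dilute-family bound of crux 18916 compares the
reach with the separation `ccol·x_j^{r₀}` (level-`j` units) of the chessboard family, so it needs the reach in units of `x_j^{r₀}`:

* §1 `one_add_mul_log_rpow_le` — the polynomial-versus-geometric inequality `(1 + s·log a)^{r₀} ≤ (max 1 r₀)^{r₀}·a^s` (`a ≥ 1`, `s ∈ ℕ`, `r₀ ≥ 0`;
  `1 + n₀u ≤ n₀e^u`, `e^{u} = a^{s/n₀}`, `(a^{s/n₀})^{r₀} ≤ a^s` for `r₀ ≤ n₀ = max 1 r₀`);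
* §2 `xlog_coupling_eq` — `x_l = x_j + (j − l)·log √L` for `l ≤ j ≤ K` (`x_l := xlog g_{K−l} = 1 + log g_{K−l}⁻¹`); `xlog_coupling_rpow_le` —
  `x_l^{r₀} ≤ (max 1 r₀)^{r₀}·x_j^{r₀}·(√L)^{j−l}` (`0 < γ ≤ 1`);
* §3 **`width_coupling_le`**, **`radius_coupling_le`** — `width l ≤ (R₁(max 1 r₀)^{r₀}x_j^{r₀} + 2d)·M₁·L^j·(√L)^{−(j−l)}` and, summing the geometric
  series (`√L ≥ 3/2`), `radius i j ≤ 3·(R₁(max 1 r₀)^{r₀}x_j^{r₀} + 2d)·M₁·L^j`; **`exists_source_within_reach`** — every fine site outside `Ω_{j+1}(h)` of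
  the rule-generated regions lies within that many fine `ℓ¹`-steps of a corner of a large-field plaquette of some level `i ≤ j`;
* §4 **`ncard_levelSites_near_le`** — the number of level-`l` sites whose image `toFine l x` lies within fine `ℓ¹`-distance `ρ` of a given fine site is at
  most `(2·⌊2dρ/L^l⌋ + 1)^d` (two such sites have `L^l·tdist ≤ 2dρ` by `HistoryTailAlphaTopFamily.pow_mul_tdist_le_of_boxes_meet`, then
  `B10Eq39CollarVolume.card_ball_le`) — the recount of `B10Eq39CollarVolume`'s fine-site cover in the units `ZtermSize` uses.

References: T. Bałaban, CMP 102 (1985) 255–275 [Balaban1985UV3] ((39) p.266, p.268, (41) p.266); CMP 109 (1987) 249–301 [Balaban1987RG1] ((0.1) p.251).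
-/

noncomputable section

open scoped BigOperators

namespace Summit.QuantumFields.YangMills.Theorems.HistoryTailTowerReach

open Literature.MathematicalPhysics.QuantumFieldTheory.Balaban1983to89
open B10LargeField (xlog one_le_xlog)
open B10Eq38TorusDomains (toFine omegaSeq collarPrinted cornerPts cornerSet)
open B10Eq39CollarVolume (width radius exists_source_of_not_mem_omegaSeq ball mem_ball card_ball_le)
open Summit.QuantumFields.YangMills.Theorems.HistoryTailAlphaTopFamily (pow_mul_tdist_le_of_boxes_meet tdist_eq_sum_natAbs_valMinAbs)

/-! ## §1 Polynomial versus geometric growth -/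

/-- **`(1 + s·log a)^{r₀} ≤ (max 1 r₀)^{r₀}·a^s`** for `a ≥ 1`, `s ∈ ℕ`, `r₀ ≥ 0`: with `n₀ = max 1 r₀` and `u = s·log a/n₀`, `1 + n₀u ≤ n₀(1 + u) ≤ n₀e^u =
n₀·a^{s/n₀}` and `(a^{s/n₀})^{r₀} = a^{s·r₀/n₀} ≤ a^s`. [folklore] -/
theorem one_add_mul_log_rpow_le {a : ℝ} (ha : 1 ≤ a) (s : ℕ) {r₀ : ℝ} (hr : 0 ≤ r₀) :
    (1 + (s : ℝ) * Real.log a) ^ r₀ ≤ (max 1 r₀) ^ r₀ * a ^ s := by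
  set n₀ : ℝ := max 1 r₀ with hn₀
  have hn₀1 : 1 ≤ n₀ := le_max_left _ _
  have hn₀0 : 0 < n₀ := zero_lt_one.trans_le hn₀1
  have hrn : r₀ ≤ n₀ := le_max_right _ _
  have ha0 : 0 < a := zero_lt_one.trans_le ha
  have hlog : 0 ≤ Real.log a := Real.log_nonneg ha
  have hs0 : (0 : ℝ) ≤ s := Nat.cast_nonneg s
  set u : ℝ := (s : ℝ) * Real.log a / n₀ with hu
  have hu0 : 0 ≤ u := div_nonneg (mul_nonneg hs0 hlog) hn₀0.le
  -- `1 + s log a ≤ n₀ · a^{s/n₀}`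
  have h1 : 1 + (s : ℝ) * Real.log a ≤ n₀ * a ^ ((s : ℝ) / n₀) := by
    have hexp : a ^ ((s : ℝ) / n₀) = Real.exp u := by
      rw [Real.rpow_def_of_pos ha0, hu]
      congr 1
      ring
    have hsu : (s : ℝ) * Real.log a = n₀ * u := by
      rw [hu]; field_simp
    rw [hexp, hsu]
    have := Real.add_one_le_exp u
    nlinarith
  have hbase : 0 ≤ 1 + (s : ℝ) * Real.log a := by positivity
  -- raise to the power `r₀`
  calc (1 + (s : ℝ) * Real.log a) ^ r₀ ≤ (n₀ * a ^ ((s : ℝ) / n₀)) ^ r₀ := Real.rpow_le_rpow hbase h1 hr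
    _ = n₀ ^ r₀ * (a ^ ((s : ℝ) / n₀)) ^ r₀ := Real.mul_rpow hn₀0.le (Real.rpow_nonneg ha0.le _)
    _ = n₀ ^ r₀ * a ^ ((s : ℝ) / n₀ * r₀) := by rw [← Real.rpow_mul ha0.le]
    _ ≤ n₀ ^ r₀ * a ^ (s : ℝ) := by
        refine mul_le_mul_of_nonneg_left (Real.rpow_le_rpow_of_exponent_le ha ?_) (Real.rpow_nonneg hn₀0.le _)
        calc (s : ℝ) / n₀ * r₀ ≤ (s : ℝ) / n₀ * n₀ := mul_le_mul_of_nonneg_left hrn (div_nonneg hs0 hn₀0.le)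
          _ = (s : ℝ) := div_mul_cancel₀ _ hn₀0.ne'
    _ = n₀ ^ r₀ * a ^ s := by rw [Real.rpow_natCast]

/-! ## §2 The coupling flow in logarithmic units -/

/-- **`x_l = x_j + (j − l)·log √L`** for `l ≤ j ≤ K`, where `x_l = xlog g_{K−l} = 1 + log g_{K−l}⁻¹`, `g_n = √(γL^{−n})` (`γ > 0`, `L > 0`).
[cite: Balaban1985UV3, (3) p.256] -/
theorem xlog_coupling_eq {γ L : ℝ} (hγ : 0 < γ) (hL : 0 < L) {l j K : ℕ} (hl : l ≤ j) (hj : j ≤ K) :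
    xlog (Real.sqrt (γ * (L⁻¹) ^ (K - l))) = xlog (Real.sqrt (γ * (L⁻¹) ^ (K - j))) + ((j - l : ℕ) : ℝ) * Real.log (Real.sqrt L) := by
  unfold xlog
  have hpos : ∀ n : ℕ, 0 < γ * (L⁻¹) ^ n := fun n => mul_pos hγ (pow_pos (inv_pos.mpr hL) n)
  have hlog : ∀ n : ℕ, Real.log (Real.sqrt (γ * (L⁻¹) ^ n))⁻¹ = -(Real.log γ + n * Real.log L⁻¹) / 2 := by
    intro n
    rw [Real.log_inv, Real.log_sqrt (hpos n).le, Real.log_mul hγ.ne' (pow_pos (inv_pos.mpr hL) n).ne', Real.log_pow]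
    ring
  rw [hlog, hlog, Real.log_sqrt hL.le, Real.log_inv]
  have : ((K - l : ℕ) : ℝ) = ((K - j : ℕ) : ℝ) + ((j - l : ℕ) : ℝ) := by
    rw [← Nat.cast_add]; congr 1; omega
  rw [this]
  ring

/-- Along the flow the unit is at least `1`: `x_j ≥ 1` for `0 < γ ≤ 1`, `L ≥ 1`. [cite: Balaban1985UV3, (7) p.257] -/
theorem one_le_xlog_coupling {γ L : ℝ} (hγ : 0 < γ) (hγ1 : γ ≤ 1) (hL : 1 ≤ L) (n : ℕ) : 1 ≤ xlog (Real.sqrt (γ * (L⁻¹) ^ n)) := by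
  have hLn : 0 < (L⁻¹) ^ n := pow_pos (inv_pos.mpr (zero_lt_one.trans_le hL)) n
  have hLn1 : (L⁻¹) ^ n ≤ 1 := pow_le_one₀ (inv_nonneg.mpr (zero_le_one.trans hL)) (inv_le_one_of_one_le₀ hL)
  refine one_le_xlog (Real.sqrt_pos.mpr (mul_pos hγ hLn)) ?_
  rw [Real.sqrt_le_one]
  calc γ * (L⁻¹) ^ n ≤ 1 * 1 := mul_le_mul hγ1 hLn1 hLn.le zero_le_one
    _ = 1 := one_mul 1

/-- **`x_l^{r₀} ≤ (max 1 r₀)^{r₀}·x_j^{r₀}·(√L)^{j−l}`** for `l ≤ j ≤ K`, `0 < γ ≤ 1`, `L ≥ 1`, `r₀ ≥ 0` (`x_l = x_j + (j−l)log √L ≤ x_j·(1 + (j−l)log √L)` since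
`x_j ≥ 1`, then §1 with `a = √L`). [cite: Balaban1985UV3, (39) p.266] -/
theorem xlog_coupling_rpow_le {γ L : ℝ} (hγ : 0 < γ) (hγ1 : γ ≤ 1) (hL : 1 ≤ L) {l j K : ℕ} (hl : l ≤ j) (hj : j ≤ K)
    {r₀ : ℝ} (hr : 0 ≤ r₀) :
    xlog (Real.sqrt (γ * (L⁻¹) ^ (K - l))) ^ r₀ ≤
      (max 1 r₀) ^ r₀ * xlog (Real.sqrt (γ * (L⁻¹) ^ (K - j))) ^ r₀ * Real.sqrt L ^ (j - l) := by
  set xj : ℝ := xlog (Real.sqrt (γ * (L⁻¹) ^ (K - j))) with hxj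
  set a : ℝ := Real.sqrt L with ha
  have hL0 : 0 < L := zero_lt_one.trans_le hL
  have ha1 : 1 ≤ a := by rw [ha]; exact Real.one_le_sqrt.mpr hL
  have hxj1 : 1 ≤ xj := one_le_xlog_coupling hγ hγ1 hL (K - j)
  have hxj0 : 0 ≤ xj := zero_le_one.trans hxj1
  have hloga : 0 ≤ Real.log a := Real.log_nonneg ha1
  have hs0 : (0 : ℝ) ≤ ((j - l : ℕ) : ℝ) := Nat.cast_nonneg _
  -- `x_l ≤ x_j · (1 + (j−l) log a)`
  have hxl : xlog (Real.sqrt (γ * (L⁻¹) ^ (K - l))) ≤ xj * (1 + ((j - l : ℕ) : ℝ) * Real.log a) := by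
    rw [xlog_coupling_eq hγ hL0 hl hj, ← hxj, ← ha]
    nlinarith [mul_nonneg hs0 hloga]
  have hxl0 : 0 ≤ xlog (Real.sqrt (γ * (L⁻¹) ^ (K - l))) := zero_le_one.trans (one_le_xlog_coupling hγ hγ1 hL (K - l))
  calc xlog (Real.sqrt (γ * (L⁻¹) ^ (K - l))) ^ r₀ ≤ (xj * (1 + ((j - l : ℕ) : ℝ) * Real.log a)) ^ r₀ := Real.rpow_le_rpow hxl0 hxl hr
    _ = xj ^ r₀ * (1 + ((j - l : ℕ) : ℝ) * Real.log a) ^ r₀ := Real.mul_rpow hxj0 (by positivity)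
    _ ≤ xj ^ r₀ * ((max 1 r₀) ^ r₀ * a ^ (j - l)) :=
        mul_le_mul_of_nonneg_left (one_add_mul_log_rpow_le ha1 (j - l) hr) (Real.rpow_nonneg hxj0 _)
    _ = (max 1 r₀) ^ r₀ * xj ^ r₀ * a ^ (j - l) := by ring

/-! ## §3 Widths and radii of the collar towers along the flow -/

variable {P : Params}

/-- `(√L)^{j−l}·L^l ≤ L^j` hence `L^l = L^j·(√L)^{−2(j−l)} ≤ L^j·(√L)^{−(j−l)}`; we use the form `(√L)^{j−l}·L^l·(√L)^{j−l} = L^j`. [folklore] -/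
private theorem sqrt_pow_mul_pow (L : ℝ) (hL : 0 ≤ L) {l j : ℕ} (hl : l ≤ j) :
    Real.sqrt L ^ (j - l) * Real.sqrt L ^ (j - l) * L ^ l = L ^ j := by
  rw [← mul_pow, Real.mul_self_sqrt hL, ← pow_add]
  congr 1; omega

/-- **THE COLLAR WIDTH ALONG THE FLOW IN UNITS OF `x_j^{r₀}`**: for `l ≤ j ≤ K`, `0 < γ ≤ 1`, `R₁ ≥ 0`, `r₀ ≥ 0`:
`width l = (R₁x_l^{r₀} + 2d)·M₁·L^l ≤ (R₁(max 1 r₀)^{r₀}x_j^{r₀} + 2d)·M₁·L^j / (√L)^{j−l}`. [cite: Balaban1985UV3, (39) p.266 and p.268] -/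
theorem width_coupling_le {γ : ℝ} (hγ : 0 < γ) (hγ1 : γ ≤ 1) (M₁ : ℕ) {R₁ r₀ : ℝ} (hR : 0 ≤ R₁) (hr : 0 ≤ r₀)
    {l j K : ℕ} (hl : l ≤ j) (hj : j ≤ K) :
    width P M₁ (collarPrinted R₁ r₀ fun i => Real.sqrt (γ * ((P.L : ℝ)⁻¹) ^ (K - i))) l ≤
      (R₁ * (max 1 r₀) ^ r₀ * xlog (Real.sqrt (γ * ((P.L : ℝ)⁻¹) ^ (K - j))) ^ r₀ + 2 * P.d) * M₁ * (P.L : ℝ) ^ j /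
        Real.sqrt (P.L : ℝ) ^ (j - l) := by
  have hL1 : (1 : ℝ) ≤ (P.L : ℝ) := by exact_mod_cast P.hL.2.le
  have hL0 : (0 : ℝ) ≤ (P.L : ℝ) := zero_le_one.trans hL1
  set xj : ℝ := xlog (Real.sqrt (γ * ((P.L : ℝ)⁻¹) ^ (K - j))) with hxj
  set a : ℝ := Real.sqrt (P.L : ℝ) with ha
  have ha1 : 1 ≤ a := by rw [ha]; exact Real.one_le_sqrt.mpr hL1
  have has : 1 ≤ a ^ (j - l) := one_le_pow₀ ha1
  have has0 : 0 < a ^ (j - l) := zero_lt_one.trans_le has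
  have hxj0 : 0 ≤ xj ^ r₀ := Real.rpow_nonneg (zero_le_one.trans (one_le_xlog_coupling hγ hγ1 hL1 (K - j))) _
  have hpow := xlog_coupling_rpow_le hγ hγ1 hL1 hl hj hr (K := K)
  rw [← hxj, ← ha] at hpow
  unfold width
  rw [B10Eq38TorusDomains.collarPrinted_eq, le_div_iff₀ has0]
  -- `(R₁x_l^{r₀} + 2d)M₁L^l·a^{j−l} ≤ (R₁n₀^{r₀}x_j^{r₀} + 2d)M₁·L^j`
  have hLl : a ^ (j - l) * a ^ (j - l) * (P.L : ℝ) ^ l = (P.L : ℝ) ^ j := sqrt_pow_mul_pow (P.L : ℝ) hL0 hl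
  have hM0 : (0 : ℝ) ≤ (M₁ : ℝ) := Nat.cast_nonneg _
  have hLl0 : (0 : ℝ) ≤ (P.L : ℝ) ^ l := by positivity
  have hd0 : (0 : ℝ) ≤ 2 * (P.d : ℝ) := by positivity
  have hxl : R₁ * (1 + Real.log (Real.sqrt (γ * ((P.L : ℝ)⁻¹) ^ (K - l)))⁻¹) ^ r₀ ≤ R₁ * ((max 1 r₀) ^ r₀ * xj ^ r₀) * a ^ (j - l) := by
    have : (1 + Real.log (Real.sqrt (γ * ((P.L : ℝ)⁻¹) ^ (K - l)))⁻¹) ^ r₀ ≤ (max 1 r₀) ^ r₀ * xj ^ r₀ * a ^ (j - l) := hpow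
    nlinarith
  have hsum : R₁ * (1 + Real.log (Real.sqrt (γ * ((P.L : ℝ)⁻¹) ^ (K - l)))⁻¹) ^ r₀ + 2 * P.d ≤
      R₁ * ((max 1 r₀) ^ r₀ * xj ^ r₀) * a ^ (j - l) + 2 * P.d * a ^ (j - l) := by
    linarith [mul_le_mul_of_nonneg_left has hd0]
  have hfac : (0 : ℝ) ≤ (M₁ : ℝ) * (P.L : ℝ) ^ l * a ^ (j - l) := by positivity
  calc (R₁ * (1 + Real.log (Real.sqrt (γ * ((P.L : ℝ)⁻¹) ^ (K - l)))⁻¹) ^ r₀ + 2 * P.d) * M₁ * (P.L : ℝ) ^ l * a ^ (j - l)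
      = (R₁ * (1 + Real.log (Real.sqrt (γ * ((P.L : ℝ)⁻¹) ^ (K - l)))⁻¹) ^ r₀ + 2 * P.d) * ((M₁ : ℝ) * (P.L : ℝ) ^ l * a ^ (j - l)) := by
        ring
    _ ≤ (R₁ * ((max 1 r₀) ^ r₀ * xj ^ r₀) * a ^ (j - l) + 2 * P.d * a ^ (j - l)) * ((M₁ : ℝ) * (P.L : ℝ) ^ l * a ^ (j - l)) :=
        mul_le_mul_of_nonneg_right hsum hfac
    _ = (R₁ * (max 1 r₀) ^ r₀ * xj ^ r₀ + 2 * P.d) * M₁ * (a ^ (j - l) * a ^ (j - l) * (P.L : ℝ) ^ l) := by ring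
    _ = (R₁ * (max 1 r₀) ^ r₀ * xj ^ r₀ + 2 * P.d) * M₁ * (P.L : ℝ) ^ j := by rw [hLl]

/-- `√L ≥ 3/2` for the series' parameters (`L` odd, `L > 1`, so `L ≥ 3`). [folklore] -/
theorem three_halves_le_sqrt_L (P : Params) : (3 / 2 : ℝ) ≤ Real.sqrt (P.L : ℝ) := by
  have hL3 : (3 : ℝ) ≤ (P.L : ℝ) := by
    obtain ⟨hodd, hgt⟩ := P.hL
    rcases hodd with ⟨m, hm⟩
    exact_mod_cast (by omega : 3 ≤ P.L)
  rw [Real.le_sqrt' (by norm_num : (0 : ℝ) < 3 / 2)]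
  nlinarith

/-- The geometric series with ratio `1/√L ≤ 2/3`: `Σ_{l ∈ Icc i j} (√L)^{−(j−l)} ≤ 3`. [folklore] -/
theorem sum_inv_sqrt_pow_le (P : Params) (i j : ℕ) :
    ∑ l ∈ Finset.Icc i j, (Real.sqrt (P.L : ℝ) ^ (j - l))⁻¹ ≤ 3 := by
  set q : ℝ := (Real.sqrt (P.L : ℝ))⁻¹ with hq
  have ha : (3 / 2 : ℝ) ≤ Real.sqrt (P.L : ℝ) := three_halves_le_sqrt_L P
  have ha0 : 0 < Real.sqrt (P.L : ℝ) := by linarith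
  have hq0 : 0 ≤ q := by rw [hq]; positivity
  have hq1 : q ≤ 2 / 3 := by
    rw [hq, inv_le_comm₀ ha0 (by norm_num)]
    linarith
  have hql : q < 1 := by linarith
  have hsub : Finset.Icc i j ⊆ Finset.range (j + 1) := fun l hl =>
    Finset.mem_range.mpr (by have := (Finset.mem_Icc.mp hl).2; omega)
  have hrefl : ∑ l ∈ Finset.range (j + 1), q ^ (j - l) = ∑ s ∈ Finset.range (j + 1), q ^ s := by
    have h := Finset.sum_range_reflect (fun s => q ^ s) (j + 1)
    simp only [Nat.add_sub_cancel] at h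
    exact h
  calc ∑ l ∈ Finset.Icc i j, (Real.sqrt (P.L : ℝ) ^ (j - l))⁻¹ = ∑ l ∈ Finset.Icc i j, q ^ (j - l) := by
        refine Finset.sum_congr rfl fun l _ => ?_
        rw [hq, inv_pow]
    _ ≤ ∑ l ∈ Finset.range (j + 1), q ^ (j - l) := Finset.sum_le_sum_of_subset_of_nonneg hsub fun l _ _ => pow_nonneg hq0 _
    _ = ∑ s ∈ Finset.range (j + 1), q ^ s := hrefl
    _ ≤ (1 - q)⁻¹ := sum_le_hasSum _ (fun s _ => pow_nonneg hq0 s) (hasSum_geometric_of_lt_one hq0 hql)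
    _ ≤ 3 := by
        rw [inv_le_comm₀ (by linarith) (by norm_num)]
        linarith

/-- **THE REACH OF A COLLAR TOWER ALONG THE FLOW**: for `i ≤ j ≤ K`, `0 < γ ≤ 1`, `R₁ ≥ 0`, `r₀ ≥ 0`, the accumulated widths of the passages `i, …, j` obey
`radius i j = Σ_{l=i}^{j} (R₁x_l^{r₀} + 2d)M₁L^l ≤ 3·(R₁(max 1 r₀)^{r₀}·x_j^{r₀} + 2d)·M₁·L^j` — uniformly in the source level `i`.
[cite: Balaban1985UV3, (39) p.266 and p.268] -/
theorem radius_coupling_le {γ : ℝ} (hγ : 0 < γ) (hγ1 : γ ≤ 1) (M₁ : ℕ) {R₁ r₀ : ℝ} (hR : 0 ≤ R₁) (hr : 0 ≤ r₀)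
    (i : ℕ) {j K : ℕ} (hj : j ≤ K) :
    radius P M₁ (collarPrinted R₁ r₀ fun l => Real.sqrt (γ * ((P.L : ℝ)⁻¹) ^ (K - l))) i j ≤
      3 * ((R₁ * (max 1 r₀) ^ r₀ * xlog (Real.sqrt (γ * ((P.L : ℝ)⁻¹) ^ (K - j))) ^ r₀ + 2 * P.d) * M₁ * (P.L : ℝ) ^ j) := by
  have hL1 : (1 : ℝ) ≤ (P.L : ℝ) := by exact_mod_cast P.hL.2.le
  set C : ℝ := (R₁ * (max 1 r₀) ^ r₀ * xlog (Real.sqrt (γ * ((P.L : ℝ)⁻¹) ^ (K - j))) ^ r₀ + 2 * P.d) * M₁ * (P.L : ℝ) ^ j with hC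
  have hC0 : 0 ≤ C := by
    have : 0 ≤ xlog (Real.sqrt (γ * ((P.L : ℝ)⁻¹) ^ (K - j))) ^ r₀ :=
      Real.rpow_nonneg (zero_le_one.trans (one_le_xlog_coupling hγ hγ1 hL1 (K - j))) _
    rw [hC]; positivity
  unfold radius
  calc ∑ l ∈ Finset.Icc i j, width P M₁ (collarPrinted R₁ r₀ fun l => Real.sqrt (γ * ((P.L : ℝ)⁻¹) ^ (K - l))) l
      ≤ ∑ l ∈ Finset.Icc i j, C / Real.sqrt (P.L : ℝ) ^ (j - l) := by
        refine Finset.sum_le_sum fun l hl => ?_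
        have hlj : l ≤ j := (Finset.mem_Icc.mp hl).2
        rw [hC]
        exact width_coupling_le hγ hγ1 M₁ hR hr hlj hj
    _ = C * ∑ l ∈ Finset.Icc i j, (Real.sqrt (P.L : ℝ) ^ (j - l))⁻¹ := by
        rw [Finset.mul_sum]
        refine Finset.sum_congr rfl fun l _ => ?_
        rw [div_eq_mul_inv]
    _ ≤ C * 3 := mul_le_mul_of_nonneg_left (sum_inv_sqrt_pow_le P i j) hC0
    _ = 3 * C := mul_comm _ _

/-- **EVERY SITE OUTSIDE `Ω_{j+1}` IS WITHIN `3(R₁(max 1 r₀)^{r₀}x_j^{r₀} + 2d)M₁L^j` FINE `ℓ¹`-STEPS OF A LARGE-FIELD CORNER OF SOME LEVEL `i ≤ j`** — the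
collar cover `B10Eq39CollarVolume.exists_source_of_not_mem_omegaSeq` with the reach bounded along the flow (regions generated by the printed rule from
`Ω₀ = T_η` and the corner points of the large-field plaquette sets `S i`; `M₁ ≥ 1`, `j ≤ K`, `0 < γ ≤ 1`, `R₁, r₀ ≥ 0`). [cite: Balaban1985UV3, (39) p.266 and p.268] -/
theorem exists_source_within_reach {γ : ℝ} (hγ : 0 < γ) (hγ1 : γ ≤ 1) {M₁ : ℕ} (hM : 0 < M₁) {R₁ r₀ : ℝ} (hR : 0 ≤ R₁) (hr : 0 ≤ r₀)
    {K j : ℕ} (hj : j ≤ K) (S : (i : ℕ) → Finset (Plaq P i)) {y : Site P 0}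
    (hy : y ∉ omegaSeq P M₁ (collarPrinted R₁ r₀ fun l => Real.sqrt (γ * ((P.L : ℝ)⁻¹) ^ (K - l))) Set.univ
      (fun i => cornerPts i (S i)) (j + 1)) :
    ∃ i, i ≤ j ∧ ∃ p ∈ S i, ∃ x ∈ cornerSet i p,
      (Site.tdist x y : ℝ) ≤ 3 * ((R₁ * (max 1 r₀) ^ r₀ * xlog (Real.sqrt (γ * ((P.L : ℝ)⁻¹) ^ (K - j))) ^ r₀ + 2 * P.d) * M₁ * (P.L : ℝ) ^ j) := by
  obtain ⟨i, hi, x, hx, hd⟩ := exists_source_of_not_mem_omegaSeq hM _ _ hy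
  simp only [cornerPts, Set.mem_iUnion] at hx
  obtain ⟨p, hp, hxp⟩ := hx
  exact ⟨i, hi, p, hp, x, hxp, hd.trans (radius_coupling_le hγ hγ1 M₁ hR hr i hj)⟩

/-! ## §4 Recounting a fine neighbourhood in level-`l` sites -/

/-- A fine site within `ℓ¹`-distance `ρ` of `toFine l x` lies in the coordinate box of radius `ρ` around it (every coordinate's cyclic distance is at
most the total `ℓ¹` distance). [folklore] -/
theorem box_of_tdist_le {l : ℕ} (x : Site P l) (z : Site P 0) {ρ : ℕ} (h : Site.tdist (toFine l x) z ≤ ρ) :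
    ∀ ι, ∃ e : ℤ, |e| ≤ (ρ : ℤ) ∧ z ι = toFine l x ι + (e : ZMod (P.sitesPerDir 0)) := by
  intro ι
  refine ⟨-((toFine l x ι - z ι).valMinAbs), ?_, ?_⟩
  · have hle : ((toFine l x ι - z ι).valMinAbs).natAbs ≤ Site.tdist (toFine l x) z := by
      rw [tdist_eq_sum_natAbs_valMinAbs]
      exact Finset.single_le_sum (f := fun μ => ((toFine l x μ - z μ).valMinAbs).natAbs) (fun μ _ => Nat.zero_le _)
        (Finset.mem_univ ι)
    rw [abs_neg, Int.abs_eq_natAbs]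
    exact_mod_cast hle.trans h
  · rw [Int.cast_neg, ZMod.coe_valMinAbs]
    ring

/-- **THE NUMBER OF LEVEL-`l` SITES NEAR A FINE SITE**: for `l ≤ m + K`, a fine site `z` and `ρ ∈ ℕ`, at most `(2·⌊2dρ/L^l⌋ + 1)^d` sites `x` of `T^{(l)}`
have `tdist(toFine l x, z) ≤ ρ` (two of them are within `2dρ/L^l` of each other at level `l`: `HistoryTailAlphaTopFamily.pow_mul_tdist_le_of_boxes_meet`;
then the ball count `B10Eq39CollarVolume.card_ball_le`) — converts fine-site collar volumes into the level-`l` site counts of `ZtermSize`.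
[cite: Balaban1985UV3, (41) p.266] -/
theorem ncard_levelSites_near_le {l : ℕ} (hl : l ≤ P.m + P.K) (z : Site P 0) (ρ : ℕ) :
    ({x : Site P l | Site.tdist (toFine l x) z ≤ ρ} : Set (Site P l)).ncard ≤ (2 * (2 * P.d * ρ / P.L ^ l) + 1) ^ P.d := by
  classical
  by_cases hne : ({x : Site P l | Site.tdist (toFine l x) z ≤ ρ} : Set (Site P l)).Nonempty
  · obtain ⟨x₀, hx₀⟩ := hne
    have hLl : 0 < P.L ^ l := pow_pos P.L_pos l
    have hball : ({x : Site P l | Site.tdist (toFine l x) z ≤ ρ} : Set (Site P l)) ⊆ ↑(ball x₀ (2 * P.d * ρ / P.L ^ l)) := by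
      intro x hx
      rw [Finset.mem_coe, mem_ball, Nat.le_div_iff_mul_le hLl]
      have h := pow_mul_tdist_le_of_boxes_meet hl (box_of_tdist_le x₀ z hx₀) (box_of_tdist_le x z hx)
      have h' : ((P.L ^ l * Site.tdist x₀ x : ℕ) : ℤ) ≤ ((2 * P.d * ρ : ℕ) : ℤ) := by
        push_cast
        linarith
      have h'' : P.L ^ l * Site.tdist x₀ x ≤ 2 * P.d * ρ := by exact_mod_cast h'
      rwa [mul_comm] at h''
    calc ({x : Site P l | Site.tdist (toFine l x) z ≤ ρ} : Set (Site P l)).ncard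
        ≤ (↑(ball x₀ (2 * P.d * ρ / P.L ^ l)) : Set (Site P l)).ncard := Set.ncard_le_ncard hball (Finset.finite_toSet _)
      _ = (ball x₀ (2 * P.d * ρ / P.L ^ l)).card := Set.ncard_coe_finset _
      _ ≤ (2 * (2 * P.d * ρ / P.L ^ l) + 1) ^ P.d := card_ball_le _ _
  · rw [Set.not_nonempty_iff_eq_empty.mp hne, Set.ncard_empty]
    exact Nat.zero_le _

end Summit.QuantumFields.YangMills.Theorems.HistoryTailTowerReach

end
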